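import Summits.Ventures.PercRepro.S1CoreCapSixCost

/-!
# PercRepro — TOWARDS `Q*(6) = 16`: TWO BIG LINES, ONE OF WEIGHT 5 (p1, gen 25)

The case of exactly two lines `A, B` of `≥ 4` points with `wsum A = 5` (a simple 5-point line or a 4-point line
with a fat point), the other lines `T` being 3-point lines. The ordering `A, B` costs `3 + (|B| − 2) ≥ 5`, so over
`P₀ = B ∪ A` the family `T` has at most one free line in any order and no new fat point (`free_le_one`,
`fat_le_one_of_heavy`). Hence either `#T ≤ 1`, or every line of `T` is a chord through one common hub `v ∉ P₀`
(`sdiff_eq_of_free_le_one`); the chords through `v` form a free sequence over `A` alone (their points on `B` are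
new), so the master inequality over `[A]` gives `#T ≤ 8 − |A| − fat A = 3` (`card_le_three_of_heavy`). Every
chord has cap `≤ 2`, so the cap sum is `≤ 5 + 5 + 2 · 3 = 16` (`sum_cap_le_sixteen_of_two_heavy`).
`proofs/P1-S4-CAPBRIDGE.md` §17. Axioms: standard.
-/

namespace PercRepro

namespace S1

namespace FourCap

variable {β : Type} [DecidableEq β]

/-- The fat points of a union split along the second set. -/
theorem fat_union_eq (w : β → ℕ) (S T : Finset β) : fat w (S ∪ T) = fat w (S \ T) + fat w T := by
  unfold fat
  rw [← Finset.sdiff_union_self_eq_union, Finset.filter_union, Finset.card_union_of_disjoint]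
  exact Finset.disjoint_filter_filter Finset.sdiff_disjoint

section TwoHeavy

variable {w : β → ℕ} {ls : Finset (Finset β)}
  (h1 : ∀ L ∈ ls, ∀ v ∈ L, w v = 1 ∨ w v = 2)
  (h2 : ∀ L ∈ ls, 3 ≤ L.card ∧ wsum w L ≤ 5)
  (h3 : ∀ L ∈ ls, ∀ L' ∈ ls, L ≠ L' → (L ∩ L').card ≤ 1)
  (h4 : ∀ l : List (Finset β), l.Nodup → (∀ L ∈ l, L ∈ ls) → wsum w (unionL l) ≤ 6 + lineRank l)
  {A B : Finset β} (hA : A ∈ ls) (hB : B ∈ ls) (hBA : B ≠ A)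
  (cA : 4 ≤ A.card) (cB : 4 ≤ B.card) (wA : wsum w A = 5)
  (hrest : ∀ L ∈ ls, L ≠ A → L ≠ B → L.card = 3)

omit [DecidableEq β] in
/-- Every line of a configuration has at least two points (for `costSum_le`). -/
theorem two_le_card_of_spec'' {w : β → ℕ} {ls : Finset (Finset β)}
    (h2 : ∀ L ∈ ls, 3 ≤ L.card ∧ wsum w L ≤ 5) : ∀ L ∈ ls, 2 ≤ L.card :=
  fun L hL => le_trans (by omega) (h2 L hL).1

omit [DecidableEq β] in
include h1 hA wA in
/-- `|A| + fat A = 5`. -/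
theorem card_add_fat_A : A.card + fat w A = 5 := by
  have := wsum_eq_card_add_fat w A (h1 A hA)
  omega

include h3 hA hB hrest in
/-- A line other than `A, B` is not covered by `P₀ = B ∪ A`. -/
theorem not_subset_heavy {X : Finset β} (hX : X ∈ ls) (hXA : X ≠ A) (hXB : X ≠ B) : ¬ X ⊆ B ∪ A := by
  intro hsub
  have hc := hrest X hX hXA hXB
  have hXU : X ∩ (B ∪ A) = X := Finset.inter_eq_left.2 hsub
  have hle := card_inter_union_le X B A
  rw [hXU] at hle
  have := h3 X hX B hB hXB
  have := h3 X hX A hA hXA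
  omega

include h1 h2 h3 h4 hA hB hBA cA cB wA hrest in
/-- **The budget over `P₀ = B ∪ A`**: `freeCountR P₀ l + fat (unionLR P₀ l) ≤ 10 − |A| − |B|`. -/
theorem budget_heavy (l : List (Finset β)) (hnd : l.Nodup) (hl : ∀ L ∈ l, L ∈ ls ∧ L ≠ A ∧ L ≠ B) :
    freeCountR (B ∪ A) l + fat w (unionLR (B ∪ A) l) + A.card + B.card ≤ 10 := by
  have hnd' : (l ++ [B, A]).Nodup := by
    refine List.Nodup.append hnd (by simp [hBA]) ?_
    intro X hXl hX'
    simp only [List.mem_cons, List.not_mem_nil, or_false] at hX'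
    rcases hX' with rfl | rfl
    · exact (hl X hXl).2.2 rfl
    · exact (hl X hXl).2.1 rfl
  have hls : ∀ L ∈ l ++ [B, A], L ∈ ls := by
    intro L hL
    rcases List.mem_append.1 hL with h | h
    · exact (hl L h).1
    · simp only [List.mem_cons, List.not_mem_nil, or_false] at h
      rcases h with rfl | rfl
      · exact hB
      · exact hA
  have h := budget_of_prefix h1 (two_le_card_of_spec'' h2) h4 [B, A] l hnd' hls
    (fun L hL => hrest L (hl L hL).1 (hl L hL).2.1 (hl L hL).2.2)
  simp only [costSum, unionL, Finset.union_empty, Nat.zero_add] at h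
  rw [lineCost_empty, lineCost_of_inter_le_two (le_trans (h3 B hB A hA hBA) (by omega)), fat_union_eq] at h
  have := card_add_fat_A h1 hA wA
  omega

include h1 h2 h3 h4 hA hB hBA cA cB wA hrest in
/-- **At most one free line** over `P₀` in any order. -/
theorem free_le_one (l : List (Finset β)) (hnd : l.Nodup) (hl : ∀ L ∈ l, L ∈ ls ∧ L ≠ A ∧ L ≠ B) :
    freeCountR (B ∪ A) l ≤ 1 := by
  have h := budget_heavy h1 h2 h3 h4 hA hB hBA cA cB wA hrest l hnd hl
  have hfat : fat w A ≤ fat w (unionLR (B ∪ A) l) :=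
    fat_mono w (le_trans (Finset.subset_union_right (s₁ := B) (s₂ := A)) (subset_unionLR _ _))
  have := card_add_fat_A h1 hA wA
  omega

include h1 h2 h3 h4 hA hB hBA cA cB wA hrest in
/-- Every other line has at most one fat point. -/
theorem fat_le_one_of_heavy {X : Finset β} (hX : X ∈ ls) (hXA : X ≠ A) (hXB : X ≠ B) : fat w X ≤ 1 := by
  have h := budget_heavy h1 h2 h3 h4 hA hB hBA cA cB wA hrest [X] (List.nodup_singleton X)
    (by simpa using ⟨hX, hXA, hXB⟩)
  have hns := not_subset_heavy h3 hA hB hrest hX hXA hXB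
  simp only [freeCountR, unionLR, if_neg hns] at h
  have := fat_mono w (Finset.subset_union_left (s₁ := X) (s₂ := B ∪ A))
  omega

include h1 h2 h3 h4 hA hB hBA cA cB wA hrest in
/-- **Two other lines share their unique new point** (the hub). -/
theorem hub_of_heavy {X Y : Finset β} (hX : X ∈ ls) (hXA : X ≠ A) (hXB : X ≠ B) (hY : Y ∈ ls) (hYA : Y ≠ A)
    (hYB : Y ≠ B) (hXY : X ≠ Y) : X \ (B ∪ A) = Y \ (B ∪ A) ∧ (X \ (B ∪ A)).card = 1 :=
  sdiff_eq_of_free_le_one (not_subset_heavy h3 hA hB hrest hX hXA hXB) (not_subset_heavy h3 hA hB hrest hY hYA hYB)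
    (h3 X hX Y hY hXY)
    (free_le_one h1 h2 h3 h4 hA hB hBA cA cB wA hrest [Y, X] (by simp [hXY.symm])
      (by simp [hX, hXA, hXB, hY, hYA, hYB]))
    (free_le_one h1 h2 h3 h4 hA hB hBA cA cB wA hrest [X, Y] (by simp [hXY])
      (by simp [hX, hXA, hXB, hY, hYA, hYB]))

include h1 h2 h3 h4 hA hB hBA cA cB wA hrest in
/-- **At most three other lines**: with two of them, all pass through a common hub `v ∉ A` and form a free
sequence over `A` (their points on `B` are new), so the master inequality over `[A]` gives `#T ≤ 8 − |A| − fat A`. -/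
theorem card_le_three_of_heavy : ((ls.erase A).erase B).card ≤ 3 := by
  set T := (ls.erase A).erase B with hT
  have hTmem : ∀ X ∈ T, X ∈ ls ∧ X ≠ A ∧ X ≠ B := by
    intro X hX
    rw [hT, Finset.mem_erase, Finset.mem_erase] at hX
    exact ⟨hX.2.2, hX.2.1, hX.1⟩
  rcases (by omega : T.card ≤ 1 ∨ 1 < T.card) with hle | hlt
  · omega
  obtain ⟨X₀, hX₀, Y₀, hY₀, hne⟩ := Finset.one_lt_card.1 hlt
  obtain ⟨hX₀ls, hX₀A, hX₀B⟩ := hTmem X₀ hX₀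
  obtain ⟨hY₀ls, hY₀A, hY₀B⟩ := hTmem Y₀ hY₀
  obtain ⟨-, hc1⟩ := hub_of_heavy h1 h2 h3 h4 hA hB hBA cA cB wA hrest hX₀ls hX₀A hX₀B hY₀ls hY₀A hY₀B hne
  obtain ⟨v, hv⟩ := Finset.card_eq_one.1 hc1
  have hvP : v ∉ B ∪ A := (Finset.mem_sdiff.1 (hv ▸ Finset.mem_singleton_self v)).2
  have hvA : v ∉ A := fun h => hvP (Finset.mem_union_right _ h)
  -- every line of `T` passes through `v`
  have hall : ∀ X ∈ T, v ∈ X := by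
    intro X hX
    obtain ⟨hXls, hXA, hXB⟩ := hTmem X hX
    by_cases hXX₀ : X = X₀
    · subst hXX₀
      exact (Finset.mem_sdiff.1 (hv ▸ Finset.mem_singleton_self v)).1
    · have heq := (hub_of_heavy h1 h2 h3 h4 hA hB hBA cA cB wA hrest hXls hXA hXB hX₀ls hX₀A hX₀B hXX₀).1
      have hvX : v ∈ X \ (B ∪ A) := by rw [heq, hv]; exact Finset.mem_singleton_self v
      exact (Finset.mem_sdiff.1 hvX).1
  -- the master inequality over `[A]` with the lines of `T` as a free sequence
  have hnd' : (T.toList ++ [A]).Nodup := by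
    refine List.Nodup.append (Finset.nodup_toList T) (List.nodup_singleton A) ?_
    intro X hXl hX'
    rw [List.mem_singleton.1 hX'] at hXl
    exact (hTmem A (Finset.mem_toList.1 hXl)).2.1 rfl
  have hls : ∀ L ∈ T.toList ++ [A], L ∈ ls := by
    intro L hL
    rcases List.mem_append.1 hL with h | h
    · exact (hTmem L (Finset.mem_toList.1 h)).1
    · rw [List.mem_singleton.1 h]; exact hA
  have h := budget_of_prefix h1 (two_le_card_of_spec'' h2) h4 [A] T.toList hnd' hls
    (fun L hL => hrest L (hTmem L (Finset.mem_toList.1 hL)).1 (hTmem L (Finset.mem_toList.1 hL)).2.1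
      (hTmem L (Finset.mem_toList.1 hL)).2.2)
  simp only [costSum, unionL, Finset.union_empty, Nat.zero_add] at h
  rw [lineCost_empty, freeCountR_eq_length_of_mem' A T.toList (Finset.nodup_toList T)
    (fun L hL => ⟨hrest L (hTmem L (Finset.mem_toList.1 hL)).1 (hTmem L (Finset.mem_toList.1 hL)).2.1
      (hTmem L (Finset.mem_toList.1 hL)).2.2, hall L (Finset.mem_toList.1 hL),
      h3 L (hTmem L (Finset.mem_toList.1 hL)).1 A hA (hTmem L (Finset.mem_toList.1 hL)).2.1⟩)
    (fun L hL L' hL' hne => h3 L (hTmem L (Finset.mem_toList.1 hL)).1 L' (hTmem L' (Finset.mem_toList.1 hL')).1 hne),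
    Finset.length_toList] at h
  have hfat : fat w A ≤ fat w (unionLR A T.toList) := fat_mono w (subset_unionLR _ _)
  have := card_add_fat_A h1 hA wA
  omega

include h1 h2 h3 h4 hA hB hBA cA cB wA hrest in
/-- **Two big lines, one of weight `5`: cap sum `≤ 16`** — `5 + 5` plus at most three lines of cap `≤ 2`. -/
theorem sum_cap_le_sixteen_of_two_heavy : ∑ L ∈ ls, capPaper L.card (fat w L) ≤ 16 := by
  set T := (ls.erase A).erase B with hT
  have hTmem : ∀ X ∈ T, X ∈ ls ∧ X ≠ A ∧ X ≠ B := by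
    intro X hX
    rw [hT, Finset.mem_erase, Finset.mem_erase] at hX
    exact ⟨hX.2.2, hX.2.1, hX.1⟩
  have hB' : B ∈ ls.erase A := Finset.mem_erase.2 ⟨hBA, hB⟩
  rw [← Finset.add_sum_erase ls _ hA, ← Finset.add_sum_erase _ _ hB', ← hT]
  have hcap : ∀ X ∈ T, capPaper X.card (fat w X) ≤ 2 := by
    intro X hX
    obtain ⟨hXls, hXA, hXB⟩ := hTmem X hX
    have hf := fat_le_one_of_heavy h1 h2 h3 h4 hA hB hBA cA cB wA hrest hXls hXA hXB
    rw [hrest X hXls hXA hXB, capPaper_three_eq hf]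
    omega
  have hsum : ∑ X ∈ T, capPaper X.card (fat w X) ≤ 2 * T.card := by
    calc ∑ X ∈ T, capPaper X.card (fat w X) ≤ ∑ _X ∈ T, 2 := Finset.sum_le_sum hcap
      _ = 2 * T.card := by rw [Finset.card_eq_sum_ones, Finset.mul_sum]; simp only [mul_one]
  have hT3 := card_le_three_of_heavy h1 h2 h3 h4 hA hB hBA cA cB wA hrest
  rw [← hT] at hT3
  have hwB := wsum_eq_card_add_fat w B (h1 B hB)
  have hA5 := card_add_fat_A h1 hA wA
  have hB5 := (h2 B hB).2
  have := capPaper_le_five (k := A.card) (f := fat w A) (h2 A hA).1 (by omega)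
  have := capPaper_le_five (k := B.card) (f := fat w B) (h2 B hB).1 (by omega)
  omega

end TwoHeavy

end FourCap

end S1

end PercRepro
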